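import Summits.Schanuel.Schanuel.Theorems.RootDecomp1KRadical02

/-!
# RootDecomp1KRadical («RADICAL CELLS», lens 6 gen 11) — continuation (RootDecomp1KRadical03): §23e FINITE TRANSCENDENCE TYPE (Lang) — `def FiniteTranscendenceType` — instances W (e^β, β ∈ ℚ̄^×, mod the binder hW : WMeasure = W78 Cor 3.9) and π (UNCONDITIONAL, NW96 Thm 2(2) tree-proved) + §23f the C¹ function linF

Part of the six-file split (400-line rule) of lens 6's gen-11 node «RADICAL CELLS» = HOME/decomp-schanuel-lens-6/g11/addendum/RadicalCells.lean (sha256 16cddffc…, 2182 l;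
1K ROUND 8 THEOREM ROUND, PATH T; critic VERDICT 2026-08-30T18:23:36Z ACCEPTED; census C-7bis; `--supports stmt-Schanuel-33363`). Port hygiene: the node's COPY blocks of §19/§21/§22
declarations are NOT re-declared — they are the landed ones of Theorems/RootDecomp1KDark*/Torsion*/Kummer* (opened by name); twins of private/foreign tree lemmas are private here.
All parts share the namespace `Summit.Schanuel.Schanuel.Theorems.RootDecomp1KRadical`; the node docstring is in part 01. Sorry-free; standard axioms. Nothing here proves Schanuel; rung 0.
-/

noncomputable section

open Complex IntermediateField Polynomial

namespace Summit.Schanuel.Schanuel.Theorems.RootDecomp1KRadical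

open Summit.Schanuel.Schanuel.Theorems.RootDecomp1KHyper (len len_nonneg one_le_len abs_coeff_le_len)
open Summit.Schanuel.Schanuel.Theorems.RootDecomp1KHyper.HyperCell (norm_aeval_le_len_mul_pow conjFactor sliceAt
  relHat resPoly eval_conjFactor eval_sliceAt natDegree_conjFactor_le coeff_conjFactor natDegree_sliceAt_le
  natDegree_relHat_le evC evC_apply evC_comp_C map_relHat_evC relLen relLen_nonneg eval_map_int
  isAlgebraic_of_aeval_int norm_multiset_map_prod_le multiset_map_prod_le torCo torG aeval_torG natDegree_torG_le
  coeff_torG torCo_cast_eq eval_conjFactor_torG torD coeff_torD torD_ne_zero coeff_torG_eq_torD denBound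
  den_lt_denBound norm_mvaeval_le cP cP_nonneg one_le_cP abs_torCo_le abs_coeff_torG_le len_torG_le relLen_torG_le
  pow_le_exp_mul eta_lt_delta upper_exp algebraicIndependent_of_forall_int HyperLiouville.rat_mul
  dvd_of_irreducible_of_common_root pair_bounds HyperLiouville.ne_ratCast HyperLiouville.ne_zero HyperLiouville.neg)

variable {K : ℕ}

open Summit.Schanuel.Schanuel.Theorems.RootDecomp1KHyper.HyperCell (HyperLiouville)
open Summit.Schanuel.Schanuel.Theorems.RootDecomp1KHyper (WMeasure SB SFset sb_of_algebraicIndependent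
  mem_adjoin_SFset_I')

/-- an algebraic number over `ℚ` has a non-zero INTEGER polynomial -/
private theorem exists_int_poly_of_isAlgebraic {x : ℂ} (hx : IsAlgebraic ℚ x) :
    ∃ P : ℤ[X], P ≠ 0 ∧ aeval x P = 0 := by
  obtain ⟨P, hP0, hP⟩ := (IsFractionRing.isAlgebraic_iff ℤ ℚ ℂ).mpr hx
  exact ⟨P, hP0, hP⟩

/-- `Real.log x ≤ x`. -/
private theorem log_le_self_of_pos {x : ℝ} (hx : 0 < x) : Real.log x ≤ x := by
  linarith [Real.log_le_sub_one_of_pos hx]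

/-- `log log 16 > 1` (as in the tree's `RootDecomp1KHyper02`). -/
private theorem one_lt_log_log_sixteen : (1 : ℝ) < Real.log (Real.log 16) := by
  have h2 : (0.6931471803 : ℝ) < Real.log 2 := Real.log_two_gt_d9
  have h16 : Real.log 16 = 4 * Real.log 2 := by
    rw [show (16 : ℝ) = 2 ^ 4 by norm_num, Real.log_pow]; norm_num
  have he : Real.exp 1 < Real.log 16 := by
    rw [h16]; have := Real.exp_one_lt_d9; linarith
  rwa [Real.lt_log_iff_exp_lt (by rw [h16]; linarith)]

/-! ### 23e. FINITE TRANSCENDENCE TYPE (Lang): a transcendence measure polynomial in `deg` and `log H` -/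

/-- `y ∈ ℂ` has FINITE TRANSCENDENCE TYPE: for some `c > 0`, `τ ∈ ℕ`, every non-zero `S ∈ ℤ[X]` with
`deg S ≤ N` (`N ≥ 1`) and coefficients `≤ H` in absolute value (`H ≥ 16`) has
`|S(y)| ≥ exp(−c (N + log H)^τ)` (Lang's transcendence type, with the size `N + log H`). -/
def FiniteTranscendenceType (y : ℂ) : Prop :=
  ∃ (c : ℝ) (τ : ℕ), 0 < c ∧ ∀ (S : ℤ[X]) (N H : ℕ), S ≠ 0 → 1 ≤ N → S.natDegree ≤ N → 16 ≤ H →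
    (∀ k, |S.coeff k| ≤ (H : ℤ)) → Real.exp (-(c * ((N : ℝ) + Real.log H) ^ τ)) ≤ ‖aeval y S‖

/-- a number of finite transcendence type is transcendental (the `H`-aspect alone gives it) -/
theorem FiniteTranscendenceType.transcendental {y : ℂ} (hy : FiniteTranscendenceType y) :
    Transcendental ℚ y := by
  intro halg
  obtain ⟨P, hP0, hP⟩ := exists_int_poly_of_isAlgebraic halg
  obtain ⟨c, τ, _, hall⟩ := hy
  have hcoef : ∀ k, |P.coeff k| ≤ ((max 16 (len P).toNat : ℕ) : ℤ) := by
    intro k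
    refine (abs_coeff_le_len P k).trans ?_
    have h1 : ((len P).toNat : ℤ) = len P := Int.toNat_of_nonneg (len_nonneg P)
    have h2 : (len P).toNat ≤ max 16 (len P).toNat := le_max_right _ _
    calc len P = ((len P).toNat : ℤ) := h1.symm
      _ ≤ ((max 16 (len P).toNat : ℕ) : ℤ) := by exact_mod_cast h2
  have h := hall P (P.natDegree + 1) (max 16 (len P).toNat) hP0 (by omega) (by omega)
    (le_max_left _ _) hcoef
  rw [hP, norm_zero] at h
  exact absurd h (not_le.mpr (Real.exp_pos _))

/-- the length of `S` is at most `(N + 1) H` -/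
theorem sum_abs_coeff_le {S : ℤ[X]} {N H : ℕ} (hdeg : S.natDegree ≤ N)
    (hcoef : ∀ k, |S.coeff k| ≤ (H : ℤ)) :
    (∑ k ∈ Finset.range (S.natDegree + 1), |S.coeff k|) ≤ (((N + 1) * H : ℕ) : ℤ) := by
  calc (∑ k ∈ Finset.range (S.natDegree + 1), |S.coeff k|)
      ≤ ∑ k ∈ Finset.range (S.natDegree + 1), (H : ℤ) := Finset.sum_le_sum fun k _ => hcoef k
    _ = ((S.natDegree + 1 : ℕ) : ℤ) * H := by rw [Finset.sum_const, Finset.card_range]; simp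
    _ ≤ ((N + 1 : ℕ) : ℤ) * H := by gcongr
    _ = (((N + 1) * H : ℕ) : ℤ) := by push_cast; ring

/-! #### Instance W: `e^β`, `β ∈ ℚ̄^×`, has finite transcendence type (Waldschmidt 1978 Cor. 3.9 = `WMeasure`) -/

/-- Waldschmidt's exponent is `≤ C (N + log H)^5`. -/
theorem w_exponent_le {C : ℝ} {N H : ℕ} (hC : 0 ≤ C) (hN : 1 ≤ N) (hH : 16 ≤ H) :
    C * (N : ℝ) ^ 2 * (Real.log H + Real.log N) * (Real.log (Real.log H) + Real.log N) ^ 2 /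
      (Real.log (Real.log H) + Real.log (max 1 (Real.log N))) ^ 2 ≤
      C * ((N : ℝ) + Real.log H) ^ 5 := by
  have hN1 : (1 : ℝ) ≤ N := by exact_mod_cast hN
  have hH16 : (16 : ℝ) ≤ H := by exact_mod_cast hH
  have hlogH0 : 0 < Real.log H := Real.log_pos (by linarith)
  have hll1 : 1 ≤ Real.log (Real.log H) :=
    (one_lt_log_log_sixteen.trans_le (Real.log_le_log (Real.log_pos (by norm_num : (1 : ℝ) < 16))
      (Real.log_le_log (by norm_num) hH16))).le
  have hllH : Real.log (Real.log H) ≤ Real.log H := log_le_self_of_pos hlogH0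
  have hlogN0 : 0 ≤ Real.log N := Real.log_nonneg hN1
  have hlogN : Real.log N ≤ N := log_le_self_of_pos (by linarith)
  have hLM0 : 0 ≤ Real.log (max 1 (Real.log N)) := Real.log_nonneg (le_max_left _ _)
  have hnum0 : 0 ≤ C * (N : ℝ) ^ 2 * (Real.log H + Real.log N) *
      (Real.log (Real.log H) + Real.log N) ^ 2 := by positivity
  have hden1 : 1 ≤ (Real.log (Real.log H) + Real.log (max 1 (Real.log N))) ^ 2 :=
    one_le_pow₀ (by linarith)
  refine (div_le_self hnum0 hden1).trans ?_
  have hX0 : 0 ≤ (N : ℝ) + Real.log H := by linarith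
  have a1 : (N : ℝ) ^ 2 ≤ ((N : ℝ) + Real.log H) ^ 2 := pow_le_pow_left₀ (by linarith) (by linarith) 2
  have a2 : Real.log H + Real.log N ≤ (N : ℝ) + Real.log H := by linarith
  have a3 : (Real.log (Real.log H) + Real.log N) ^ 2 ≤ ((N : ℝ) + Real.log H) ^ 2 :=
    pow_le_pow_left₀ (by linarith) (by linarith) 2
  calc C * (N : ℝ) ^ 2 * (Real.log H + Real.log N) * (Real.log (Real.log H) + Real.log N) ^ 2
      ≤ C * ((N : ℝ) + Real.log H) ^ 2 * ((N : ℝ) + Real.log H) * ((N : ℝ) + Real.log H) ^ 2 := by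
        refine mul_le_mul (mul_le_mul (mul_le_mul_of_nonneg_left a1 hC) a2 (by linarith)
          (by positivity)) a3 (by positivity) (by positivity)
    _ = C * ((N : ℝ) + Real.log H) ^ 5 := by ring

/-- **Instance W.** `e^β` (`β ≠ 0` algebraic) has finite transcendence type (`τ = 5`), mod W78 Cor. 3.9. -/
theorem finiteTranscendenceType_exp_of_W (hW : WMeasure) {β : ℂ} (hβ : IsAlgebraic ℚ β)
    (hβ0 : β ≠ 0) : FiniteTranscendenceType (cexp β) := by
  obtain ⟨C, hC, hall⟩ := hW β hβ hβ0
  refine ⟨C, 5, hC, fun S N H hS hN hdeg hH hcoef => ?_⟩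
  refine le_trans (Real.exp_le_exp.mpr ?_) (hall S N H hS hN hdeg hH hcoef)
  rw [neg_le_neg_iff]
  exact w_exponent_le hC.le hN hH

/-! #### Instance π: `π` has finite transcendence type (NW 1996 Thm 2(2), PROVED in the tree) -/

/-- Instance π, exponent bookkeeping: the NW96 Thm 2(2) measure exponent `2·10⁶ d (log L + d log d)(1 + log d)` with `L ≤ (d+1)H` is dominated by `c (N + log H) ^ 4`. -/
theorem pi_exponent_le {N H : ℕ} (hN : 1 ≤ N) (hH : 16 ≤ H) :
    2 * 10 ^ 6 * (N : ℝ) * (Real.log ((((N + 1) * H : ℕ)) : ℝ) + N * Real.log N) * (1 + Real.log N) ≤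
      8 * 10 ^ 6 * ((N : ℝ) + Real.log H) ^ 4 := by
  have hN1 : (1 : ℝ) ≤ N := by exact_mod_cast hN
  have hN0 : (0 : ℝ) < N := by linarith
  have hH16 : (16 : ℝ) ≤ H := by exact_mod_cast hH
  have hH0 : (0 : ℝ) < H := by linarith
  have hlogH0 : 0 ≤ Real.log H := Real.log_nonneg (by linarith)
  set X : ℝ := (N : ℝ) + Real.log H with hX
  have hX1 : 1 ≤ X := by linarith
  have hNX : (N : ℝ) ≤ X := by linarith
  have hlogN : Real.log N ≤ N := log_le_self_of_pos hN0
  have hlogN0 : 0 ≤ Real.log N := Real.log_nonneg hN1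
  have hlogN1 : Real.log ((N : ℝ) + 1) ≤ N := by
    have := Real.log_le_sub_one_of_pos (by linarith : (0 : ℝ) < N + 1); linarith
  have hL : Real.log ((((N + 1) * H : ℕ)) : ℝ) ≤ X := by
    push_cast
    rw [Real.log_mul (by linarith) hH0.ne']
    linarith
  have h1 : Real.log ((((N + 1) * H : ℕ)) : ℝ) + N * Real.log N ≤ 2 * X ^ 2 := by
    have : (N : ℝ) * Real.log N ≤ X * X := mul_le_mul hNX (hlogN.trans hNX) hlogN0 (by linarith)
    nlinarith
  have h1' : 0 ≤ Real.log ((((N + 1) * H : ℕ)) : ℝ) + N * Real.log N := by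
    have : (0 : ℝ) ≤ Real.log ((((N + 1) * H : ℕ)) : ℝ) := Real.log_natCast_nonneg _
    positivity
  have h2 : 1 + Real.log N ≤ 2 * X := by linarith
  calc 2 * 10 ^ 6 * (N : ℝ) * (Real.log ((((N + 1) * H : ℕ)) : ℝ) + N * Real.log N) * (1 + Real.log N)
      ≤ 2 * 10 ^ 6 * X * (2 * X ^ 2) * (2 * X) := by
        refine mul_le_mul (mul_le_mul (mul_le_mul_of_nonneg_left hNX (by norm_num)) h1 h1'
          (by positivity)) h2 (by positivity) (by positivity)
    _ = 8 * 10 ^ 6 * X ^ 4 := by ring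

open Literature.NumberTheory.Transcendental in
/-- **Instance π.** `π` has finite transcendence type (`τ = 4`) — UNCONDITIONAL: from the tree's PROVED
`NesterenkoWaldschmidt1996_thm_2_2_holds` (`|P(π)| ≥ exp(−2·10⁶ d (log L + d log d)(1 + log d))`). -/
theorem finiteTranscendenceType_pi : FiniteTranscendenceType (Real.pi : ℂ) := by
  refine ⟨8 * 10 ^ 6, 4, by norm_num, fun S N H hS hN hdeg hH hcoef => ?_⟩
  have hlen := sum_abs_coeff_le hdeg hcoef
  have hL3 : 3 ≤ (N + 1) * H := by nlinarith
  have h := NesterenkoWaldschmidt1996_thm_2_2_holds S N ((N + 1) * H) hS hN hdeg hlen hL3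
  refine le_trans (Real.exp_le_exp.mpr ?_) h
  rw [neg_le_neg_iff]
  exact pi_exponent_le hN hH

/-! ### 23f. The `C¹` function `x ↦ P(x, y, e^{ux})` -/

/-- §23f. The real `C¹` function `x ↦ P(x, y, e^{ux})` (real and imaginary parts packaged), whose Lipschitz bound transports the hyper-Liouville approximation `|ρ − p/q|` to the special conjugate factor. -/
def linF (P : MvPolynomial (Fin 3) ℤ) (u y : ℂ) (x : ℝ) : ℂ :=
  ∑ s ∈ P.support, ((P.coeff s : ℤ) : ℂ) *
    ((x : ℂ) ^ (s 0) * y ^ (s 1) * cexp (u * (x : ℂ)) ^ (s 2))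

/-- §23f. `linF` agrees with the evaluation `aeval ![x, y, cexp (u * x)] P` (definitional bookkeeping). -/
theorem linF_eq_aeval (P : MvPolynomial (Fin 3) ℤ) (u y : ℂ) (x : ℝ) :
    linF P u y x = MvPolynomial.aeval ![(x : ℂ), y, cexp (u * (x : ℂ))] P := by
  unfold linF
  rw [MvPolynomial.aeval_def, MvPolynomial.eval₂_eq']
  refine Finset.sum_congr rfl fun s _ => ?_
  rw [Fin.prod_univ_three]
  simp only [algebraMap_int_eq, eq_intCast, Matrix.cons_val_zero, Matrix.cons_val_one,
    Matrix.cons_val]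

/-- `ContDiff ℝ 1 (linF P u y)`. -/
theorem contDiff_linF (P : MvPolynomial (Fin 3) ℤ) (u y : ℂ) : ContDiff ℝ 1 (linF P u y) := by
  have hx : ContDiff ℝ 1 (fun x : ℝ => (x : ℂ)) := Complex.ofRealCLM.contDiff
  unfold linF
  refine ContDiff.sum fun s _ => ?_
  refine contDiff_const.mul (((hx.pow _).mul contDiff_const).mul ?_)
  exact (Complex.contDiff_exp.comp (contDiff_const.mul hx)).pow _

/-- §23f. A Lipschitz bound for `linF` on a compact interval (mean value theorem for the `C¹` function). -/
theorem exists_lipschitz_linF (P : MvPolynomial (Fin 3) ℤ) (u y : ℂ) (ρ : ℝ) :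
    ∃ Kl δ₁ : ℝ, 0 ≤ Kl ∧ 0 < δ₁ ∧
      ∀ x : ℝ, |x - ρ| < δ₁ → ‖linF P u y x - linF P u y ρ‖ ≤ Kl * |x - ρ| := by
  obtain ⟨K, t, ht, hK⟩ := ((contDiff_linF P u y).contDiffAt (x := ρ)).exists_lipschitzOnWith
  obtain ⟨δ₁, hδ₁, hball⟩ := Metric.mem_nhds_iff.mp ht
  refine ⟨K, δ₁, K.2, hδ₁, fun x hx => ?_⟩
  have hxt : x ∈ t := hball (by rw [Metric.mem_ball, Real.dist_eq]; exact hx)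
  have hρt : ρ ∈ t := hball (Metric.mem_ball_self hδ₁)
  have := (lipschitzOnWith_iff_dist_le_mul.mp hK) x hxt ρ hρt
  rwa [dist_eq_norm, Real.dist_eq] at this

end Summit.Schanuel.Schanuel.Theorems.RootDecomp1KRadical
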